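import Summits.BirchSwinnertonDyer.BirchSwinnertonDyer.Theses.LeadingTerm
import Literature.NumberTheory.EllipticCurves.LeadingTermPPartProofs
import Literature.NumberTheory.EllipticCurves.RegulatorProofs
import Literature.NumberTheory.EllipticCurves.MordellWeilRankZeroProofs
import Literature.NumberTheory.EllipticCurves.RegulatorBasisProofs
import Literature.NumberTheory.EllipticCurves.MordellWeilTheoremProofs
import Literature.NumberTheory.EllipticCurves.HeightsProofs
import Literature.NumberTheory.EllipticCurves.PAdicGrossZagier

/-!
# BirchSwinnertonDyer / LeadingTerm — support `RankLeOne` (stmt-BirchSwinnertonDyer-16219):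
# the known slice of leading-term consistency (Mordell–Weil rank `≤ 1`, `r_an = r_MW`)

Route `LeadingTerm`, support item `RankLeOne` (rank 9; a literature leaf, NOT a hypothesis of the
deciding theorem `closes`). For `E/ℚ` (globally minimal `W`), a good ordinary prime `p ≥ 5`, a
canonical cyclotomic `p`-adic height datum `D`, and the newform `f` of `E`, with
`r := rank_ℤ E(ℚ) ≤ 1` and `r_an = r`, the item asserts `Reg_∞ > 0`, `Ω⁺_f > 0` and the existence
of ONE rational `q` with
`L^{(r)}(E,1) = r!·q·Ω⁺_f·Reg_∞(E)` and `[T^r]L_p(f,α_p,T)·log_p(γ)^r = q·(1-α_p⁻¹)²·Reg_p(E,D)`.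

This file, first instalment: the case `r = 0` (`leadingTerm_consistency_of_rank_zero`,
UNCONDITIONAL, for every height datum `D` and every good ordinary `p`): `q = [0]⁺_f = L(E,1)/Ω⁺_f`,
by the tree theorems `IsNewformOf.entireLFunction_one_eq` (`L(E,1) = [0]⁺_f·Ω⁺_f`: Manin–Drinfeld
and `{∞,0}_f = L(E,1)`), `constantCoeff_padicLFunction_unitRoot` (Mazur–Swinnerton-Dyer 1974 §9 /
Mazur–Tate–Teitelbaum 1986 §I.14 (14.3): `L_p(E,0) = (1-α⁻¹)²[0]⁺_f`),
`regulator_eq_one_of_rank_zero` and `padicRegulator_eq_one_of_finite` (both regulators are empty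
Gram determinants; `E(ℚ)` is finite in rank `0`, `mordellWeilRank_eq_zero_iff_finite`),
`regulator_pos_holds` and `IsNewform0.plusPeriod_pos_holds`.
The case `r = 1` (Perrin-Riou's `p`-adic Gross–Zagier theorem in its `E/ℚ` leading-term form,
Perrin-Riou 1987 §1.4; Stein–Wuthrich 2013 §9) is appended once its named fact
`Literature.NumberTheory.EllipticCurves.perrinRiou_rankOne_leadingTerms` has landed.
-/

-- D-0017: single-problem summit, so `Summit.BirchSwinnertonDyer.BirchSwinnertonDyer.…` repeats a
-- namespace BY DESIGN.
set_option linter.dupNamespace false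

namespace Summit.BirchSwinnertonDyer.BirchSwinnertonDyer.Theorems

open scoped MatrixGroups ModularForm
open CongruenceSubgroup Literature.NumberTheory.EllipticCurves
  Literature.NumberTheory.EllipticCurves.ModularForms WeierstrassCurve

/-- **Leading-term consistency in Mordell–Weil rank `0`** (unconditional; Mazur–Swinnerton-Dyer
interpolation). For `E/ℚ` with globally minimal `W`, a good ordinary prime `p`, ANY height datum
`D`, and the newform `f` of `E`: if `rank_ℤ E(ℚ) = 0` then `Reg_∞(E) > 0`, `Ω⁺_f > 0`, and with
`q := [0]⁺_f ∈ ℚ` one has `L(E,1) = 0!·q·Ω⁺_f·Reg_∞` (`Reg_∞ = 1`, `L(E,1) = [0]⁺_f Ω⁺_f`: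
`IsNewformOf.entireLFunction_one_eq`) and `[T⁰]L_p(f,α)·log_p(γ)⁰ = q·(1-α⁻¹)²·Reg_p(D)`
(`Reg_p = 1`: `padicRegulator_eq_one_of_finite`, `E(ℚ)` finite in rank `0`;
`constantCoeff_padicLFunction_unitRoot`, Mazur–Tate–Teitelbaum 1986 §I.14 (14.3)).
[cite: MazurTateTeitelbaum1986Invent, §I.14 (14.3)] -/
theorem leadingTerm_consistency_of_rank_zero (W : WeierstrassCurve ℚ) [W.IsElliptic]
    [W.IsGloballyMinimal] (p : ℕ) [Fact p.Prime] (hord : IsOrdinaryAt W p)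
    (hr : W.mordellWeilRank = 0) (D : PAdicHeightData W p) {N : ℕ} [NeZero N]
    (f : CuspForm (Gamma0 N) 2) (hf : IsNewformOf W f) :
    0 < W.regulator ∧ 0 < plusPeriod f ∧ ∃ q : ℚ,
      iteratedDeriv W.mordellWeilRank W.entireLFunction 1 =
        (((W.mordellWeilRank.factorial : ℝ) * (q : ℝ) * plusPeriod f * W.regulator : ℝ) : ℂ) ∧
      PowerSeries.coeff W.mordellWeilRank (padicLFunction f (unitRoot W p : ℚ_[p])) *
          padicLog p (cyclotomicGenerator p) ^ W.mordellWeilRank =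
        (q : ℚ_[p]) * (1 - (unitRoot W p : ℚ_[p])⁻¹) ^ 2 * padicRegulator D := by
  have hreg : 0 < W.regulator := regulator_pos_holds W
  have hΩ : 0 < plusPeriod f := IsNewform0.plusPeriod_pos_holds hf.1 hf.coeffField_eq_bot
  refine ⟨hreg, hΩ, ratPlusSymbol f 0, ?_, ?_⟩
  · rw [hr, iteratedDeriv_zero, regulator_eq_one_of_rank_zero W hr, hf.entireLFunction_one_eq]
    push_cast
    ring
  · haveI : Finite W.toAffine.Point := W.mordellWeilRank_eq_zero_iff_finite.mp hr
    rw [hr, PowerSeries.coeff_zero_eq_constantCoeff_apply,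
      constantCoeff_padicLFunction_unitRoot hord hf, padicRegulator_eq_one_of_finite W p D,
      pow_zero]
    ring

/-! ### Second instalment: the case `r = 1` and the item `RankLeOne`

Conditional on the named fact `Literature.NumberTheory.EllipticCurves.perrinRiou_rankOne_leadingTerms`
(Perrin-Riou's `p`-adic Gross–Zagier theorem in its `E/ℚ` leading-term form, Perrin-Riou 1987 §1.4
Cor. 1.8; Stein–Wuthrich 2013 §9; `PAdicGrossZagier.lean`): it supplies a non-torsion `P ∈ E(ℚ)`
and `c ∈ ℚ` with `L'(E,1) = c·Ω⁺_f·ĥ(P)` and `[T¹]L_p·log_p γ = c·(1-α⁻¹)²·⟨P,P⟩_D`; writing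
`P = m·P₀ + T` on a Mordell–Weil basis `{P₀}` of the rank-one group `E(ℚ)` (`T` torsion) gives
`ĥ(P) = m²·Reg_∞` and `⟨P,P⟩_D = m²·Reg_p(D)` (bilinearity and torsion-vanishing of both pairings,
basis-independence of both regulators — all tree theorems), whence `q = c·m²`
(`leadingTerm_consistency_of_rank_one`), and `rankLeOne_of_perrinRiou :
perrinRiou_rankOne_leadingTerms → RankLeOne` by the case split `r = 0 ∨ r = 1`. -/

open WeierstrassCurve.Affine.Point

/-- **Leading-term consistency in Mordell–Weil rank `1` with `r_an = 1`**, from Perrin-Riou's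
`p`-adic Gross–Zagier theorem (named fact `perrinRiou_rankOne_leadingTerms`, hypothesis `hPR`).
The fact gives a non-torsion `P ∈ E(ℚ)` and `c ∈ ℚ` with `L'(E,1) = c·Ω⁺_f·ĥ(P)` and
`[T¹]L_p·log_p γ = c·(1-α⁻¹)²·⟨P,P⟩_D`. On a Mordell–Weil basis `{P₀}` of the rank-one group
`E(ℚ)` (`exists_isMordellWeilBasis_holds`) write `P = m·P₀ + T` with `T` torsion; bilinearity and
torsion-vanishing of the Néron–Tate pairing (`heightPairing_add_right`, `heightPairing_zsmul_right`,
`heightPairing_eq_zero_of_isOfFinAddOrder_right`, `heightPairing_self_holds`) and of `D.pairing`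
give `ĥ(P) = m²⟨P₀,P₀⟩ = m²·Reg_∞(E)` and `⟨P,P⟩_D = m²·Reg_p(E,D)` (the regulators of a rank-one
lattice are the `1 × 1` Gram determinants: `IsMordellWeilBasis.regulatorOf_eq_regulator`,
`padicRegulatorOf_eq_padicRegulator_holds`, `Matrix.det_eq_elem_of_card_eq_one`), so `q := c·m²`
serves both identities (Perrin-Riou 1987 §1.4; Stein–Wuthrich 2013 §9).
[cite: PerrinRiou1987, §1.4] -/
theorem leadingTerm_consistency_of_rank_one (hPR : perrinRiou_rankOne_leadingTerms)
    (W : WeierstrassCurve ℚ) [W.IsElliptic] [W.IsGloballyMinimal] (p : ℕ) [Fact p.Prime]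
    (h5 : 5 ≤ p) (hord : IsOrdinaryAt W p) (hr : W.mordellWeilRank = 1)
    (han : W.analyticRank = 1) (D : PAdicHeightData W p) (hD : D.IsCanonical) {N : ℕ} [NeZero N]
    (f : CuspForm (Gamma0 N) 2) (hf : IsNewformOf W f) :
    0 < W.regulator ∧ 0 < plusPeriod f ∧ ∃ q : ℚ,
      iteratedDeriv W.mordellWeilRank W.entireLFunction 1 =
        (((W.mordellWeilRank.factorial : ℝ) * (q : ℝ) * plusPeriod f * W.regulator : ℝ) : ℂ) ∧
      PowerSeries.coeff W.mordellWeilRank (padicLFunction f (unitRoot W p : ℚ_[p])) *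
          padicLog p (cyclotomicGenerator p) ^ W.mordellWeilRank =
        (q : ℚ_[p]) * (1 - (unitRoot W p : ℚ_[p])⁻¹) ^ 2 * padicRegulator D := by
  have hreg : 0 < W.regulator := regulator_pos_holds W
  have hΩ : 0 < plusPeriod f := IsNewform0.plusPeriod_pos_holds hf.1 hf.coeffField_eq_bot
  obtain ⟨P, c, -, harch, hpad⟩ := hPR W p h5 hord han D hD f hf
  -- a Mordell–Weil basis of the rank-one group `E(ℚ)` consists of one point `B k`
  obtain ⟨B, hB⟩ := W.exists_isMordellWeilBasis_holds
  have hcard : Fintype.card (Fin W.mordellWeilRank) = 1 := by rw [Fintype.card_fin, hr]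
  let k : Fin W.mordellWeilRank := ⟨0, by omega⟩
  have huniq : ∀ i : Fin W.mordellWeilRank, i = k := fun i ↦ Fin.ext (by have := i.2; omega)
  -- `P = m • B k + T` with `T` torsion, and `ĥ(P) = m² · Reg_∞(E)`.  (The generic-field files
  -- elaborate the group law on `E(ℚ)` against the classical `DecidableEq ℚ` instance, the
  -- `ℚ`-files (`PAdicHeightData`) against `instDecidableEqRat`; the block below works classically
  -- and `convert`s its two point-arithmetic outputs, the instances being equal.)
  obtain ⟨m, T, hT, hPdecomp, hreal⟩ : ∃ (m : ℤ) (T : W.toAffine.Point), IsOfFinAddOrder T ∧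
      P = m • B k + T ∧ P.canonicalHeight = (m : ℝ) ^ 2 * W.regulator := by
    letI : DecidableEq ℚ := fun a b ↦ Classical.propDecidable (a = b)
    obtain ⟨m, hm⟩ : ∃ m : ℤ, m • (QuotientAddGroup.mk (B k) : mordellWeilModTorsion W) =
        QuotientAddGroup.mk P := by
      have hmem : (QuotientAddGroup.mk P : mordellWeilModTorsion W) ∈
          Submodule.span ℤ (Set.range (QuotientAddGroup.mk ∘ B :
            Fin W.mordellWeilRank → mordellWeilModTorsion W)) := by
        rw [hB.2]; exact Submodule.mem_top
      have hrange : Set.range (QuotientAddGroup.mk ∘ B :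
          Fin W.mordellWeilRank → mordellWeilModTorsion W) = {QuotientAddGroup.mk (B k)} := by
        ext x
        simp only [Set.mem_range, Set.mem_singleton_iff, Function.comp_apply]
        constructor
        · rintro ⟨i, rfl⟩; rw [huniq i]
        · rintro rfl; exact ⟨k, rfl⟩
      rw [hrange] at hmem
      exact Submodule.mem_span_singleton.mp hmem
    set T : W.toAffine.Point := -(m • B k) + P with hT_def
    have hT : IsOfFinAddOrder T := by
      have h1 : (QuotientAddGroup.mk (m • B k) : mordellWeilModTorsion W) =
          QuotientAddGroup.mk P := by
        rw [← hm, QuotientAddGroup.mk_zsmul]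
      exact (AddCommGroup.mem_torsion _).mp (QuotientAddGroup.eq.mp h1)
    have hPdecomp : P = m • B k + T := by rw [hT_def]; abel
    -- `Reg_∞(E)` is the `1 × 1` Gram determinant `⟨B k, B k⟩`
    have hReg : W.regulator = heightPairing (B k) (B k) := by
      rw [← hB.regulatorOf_eq_regulator, regulatorOf, Matrix.det_eq_elem_of_card_eq_one hcard k,
        heightPairingMatrix_apply]
    have e1 : ∀ R, heightPairing R P = (m : ℝ) * heightPairing R (B k) := fun R ↦ by
      rw [hPdecomp, heightPairing_add_right, heightPairing_zsmul_right,
        heightPairing_eq_zero_of_isOfFinAddOrder_right R hT, add_zero]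
    have hreal : P.canonicalHeight = (m : ℝ) ^ 2 * W.regulator := by
      rw [← heightPairing_self_holds P, e1, heightPairing_symm, e1, hReg]
      ring
    refine ⟨m, T, ?_, ?_, hreal⟩
    · convert hT
    · convert hPdecomp
  -- `Reg_p(E, D)` is the `1 × 1` Gram determinant `⟨B k, B k⟩_D`
  have hRegp : padicRegulator D = D.pairing (B k) (B k) := by
    rw [← padicRegulatorOf_eq_padicRegulator_holds D hB, padicRegulatorOf]
    convert Matrix.det_eq_elem_of_card_eq_one (A := D.pairingMatrix B) hcard k
    rfl
  have e2 : ∀ R, D.pairing R P = (m : ℚ_[p]) * D.pairing R (B k) := fun R ↦ by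
    rw [hPdecomp, map_add, map_zsmul, D.map_torsion_right R T hT, add_zero, zsmul_eq_mul]
  have hpadic : D.pairing P P = (m : ℚ_[p]) ^ 2 * padicRegulator D := by
    rw [e2, D.symm P (B k), e2, hRegp]
    ring
  refine ⟨hreg, hΩ, c * m ^ 2, ?_, ?_⟩
  · rw [hr, iteratedDeriv_one, harch, hreal]
    push_cast
    ring
  · rw [hr, pow_one, hpad, hpadic]
    push_cast
    ring

/-- **The known slice of leading-term consistency** (route `LeadingTerm`, support `RankLeOne`,
stmt-BirchSwinnertonDyer-16219), CONDITIONAL on Perrin-Riou's `p`-adic Gross–Zagier theorem in its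
`E/ℚ` leading-term form (`perrinRiou_rankOne_leadingTerms`, hypothesis `hPR`): for `rank_ℤ E(ℚ) ≤ 1`
and `r_an = r_MW` the archimedean and `p`-adic BSD quotients at the index `r_MW` are one rational
number — `r = 0` unconditionally (`leadingTerm_consistency_of_rank_zero`, Mazur–Swinnerton-Dyer
interpolation), `r = 1` by `leadingTerm_consistency_of_rank_one` (Perrin-Riou 1987 §1.4;
Stein–Wuthrich 2013 §9). [cite: PerrinRiou1987, §1.4] -/
theorem rankLeOne_of_perrinRiou (hPR : perrinRiou_rankOne_leadingTerms) :
    Summit.BirchSwinnertonDyer.BirchSwinnertonDyer.Theses.LeadingTerm.RankLeOne := by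
  intro W _ _ p _ h5 hord hle heq D hD N _ f hf
  rcases Nat.le_one_iff_eq_zero_or_eq_one.mp hle with h0 | h1
  · exact leadingTerm_consistency_of_rank_zero W p hord h0 D f hf
  · exact leadingTerm_consistency_of_rank_one hPR W p h5 hord h1 (heq.trans h1) D hD f hf

end Summit.BirchSwinnertonDyer.BirchSwinnertonDyer.Theorems
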